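import Literature.AlgebraicGeometry.Resolution.EffectiveResolution
import Literature.AlgebraicGeometry.Resolution.EmbeddedResolution
import Literature.AlgebraicGeometry.Resolution.BlowupsProperProofs
import HarnessLib

/-!
# Effective resolution in large characteristic (BGMW 2011, Cor. 8.0.6): proofs

Topic: `Literature/AlgebraicGeometry/Resolution`. Sibling proof file of `EffectiveResolution.lean`,
home of the (eventual) discharge of its named fact `BierstoneGrigorievMilmanWlodarczyk2011`
(Bierstone–Grigoriev–Milman–Włodarczyk 2011, Cor. 8.0.6 in its weak non-embedded form for integral
affine `Y ⊆ 𝔸ⁿ_k`). Status of the decomposition (see `EmbeddedResolution.lean`):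

  `BierstoneGrigorievMilmanWlodarczyk2011 ⇐ Stacks02NS ∧ BierstoneGrigorievMilmanWlodarczyk2011_embedded`

(`bierstoneGrigorievMilmanWlodarczyk2011_of_embedded`, PROVED there: embedded desingularization by
blow-ups with regular centres over the singular locus ⇒ a proper birational regular model, BGMW
§3.3 (3) ⇒ (4) / Thm. 2.0.2 ⇒ Thm. 2.0.3). The first conjunct — blow-ups along ideal sheaves of
finite type are proper (Stacks 02NS; Görtz–Wedhorn I, Prop. 13.96 (1)) — is now a theorem
(`stacks02NS_holds`, `BlowupsProperProofs.lean`), so the named fact is reduced to its embedded form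
ALONE:

* `bierstoneGrigorievMilmanWlodarczyk2011_of_embedded'` :
  `BierstoneGrigorievMilmanWlodarczyk2011_embedded → BierstoneGrigorievMilmanWlodarczyk2011` — PROVED.

What remains (`BierstoneGrigorievMilmanWlodarczyk2011_embedded`, BGMW Cor. 8.0.6 with Thm. 2.0.2
(1)–(3) and Thm. 8.0.5) is the canonical resolution algorithm for marked ideals itself (BGMW §§3–4,
after Włodarczyk 2005) run in characteristic `p > M(d, n, l)` (§8) — a standing named fact.

## Sources

* E. Bierstone, D. Grigoriev, P. Milman, J. Włodarczyk, *Effective Hironaka resolution and its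
  complexity*, Asian J. Math. 15 (2011) 193–228 = arXiv:1206.3090: §3.3, Thms. 2.0.2, 2.0.3,
  Cor. 8.0.6 (arXiv numbering). [BierstoneGrigorievMilmanWlodarczyk2011]
* The Stacks Project, Tag 02NS. [StacksProject]
-/

noncomputable section

open CategoryTheory AlgebraicGeometry

namespace Literature.AlgebraicGeometry.Resolution

/-- **BGMW Cor. 8.0.6: the embedded form implies the non-embedded named fact, unconditionally**
(BGMW §3.3 (3) ⇒ (4), Thm. 2.0.2 ⇒ Thm. 2.0.3; properness of the blow-ups by `stacks02NS_holds`).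
[cite: BierstoneGrigorievMilmanWlodarczyk2011, §3.3 (3)⇒(4) and Thm. 2.0.3] -/
theorem bierstoneGrigorievMilmanWlodarczyk2011_of_embedded'
    (hE : BierstoneGrigorievMilmanWlodarczyk2011_embedded) :
    BierstoneGrigorievMilmanWlodarczyk2011 :=
  bierstoneGrigorievMilmanWlodarczyk2011_of_embedded stacks02NS_holds.{0} hE

end Literature.AlgebraicGeometry.Resolution

end
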